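import Summits.ResolutionOfSingularities.ResolutionOfSingularities.Theorems.FrobeniusClosingSteerCore4OrderOneExit
import Literature.AlgebraicGeometry.Resolution.LocalBlowupModels
import HarnessLib

/-!
# Crux `Steer` (stmt-ResolutionOfSingularities-16345), chain W4.1, R2 σ_top line: **X `SteeredExit`**
# (a steered torsor run that reaches an EXIT stage gives the conclusion; Theses-free body)

OURS (campaign `res-hironaka`, rung L ★L-G4, slot W4.1, chain W4.1, seat `res-L0-w41-stub-7` = `res-D-pv-011`;
replaces the role of no printed item; NOT a statement of the manuscript under review; AI review is weaker than
expert review). This file PROVES the dischargeable piece **X `SteeredExit`** of the planner's typed sub-plan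
`L/w41/Sketch-R2-steered.lean` (res-L0-w41-plan-1 g5, sha16 fb4f9514a6cb98fe, §3.4; card `L/w41/CRUX-PLAN-Steer-v3-R2.md`;
CHAIN W4.1 v5.3 arrival table, row `res-L0-w41-stub-7`) under the registered residual R2
`stub_core4EternalNonIsolated` of the skeleton of record r13 (`L/res-L0-w41-lead-1/Steer_r13.lean` d64d56e77534ff4a),
with ONLY the binders the proof uses and the sketch's vocabulary (`IsSteeredRunUpTo`, `IsStrictStepAlong`,
`IsLocalBlowupAlong`, `SteeredExitAt`, `IsSingPrime`, `RadicandRing`, `Concl`) read through their unfolded content,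
so that the by-name leaf for the sketch's `SteeredExit` is

  `fun p hp n _ k K _ _ _ _ _ O A₀ h₀ t hC R P s N hR0 hrun hexit => by
     obtain ⟨hfg, htp, hfr, -⟩ := hC
     obtain ⟨hs0, -, hst⟩ := hrun
     obtain ⟨hloc, hsN, hreg⟩ := hexit
     exact SteeredExit.concl_of_exit O A₀ h₀ t hfg hfr hp.pos R hR0 s N hs0
       (fun i hi => by
         obtain ⟨_, _, -, hbl, x, g, ⟨⟨hx, -⟩, -, -⟩, hg, he⟩ := hst i hi
         exact ⟨hbl.isLocalBlowup, x, g, hx, hg, he⟩)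
       hloc hsN (not_not.mp hreg)`

(kernel-checked against a HOME copy of the sketch before filing).

## Statement proved (`SteeredExit.concl_of_exit`)

For fields `k ⊆ K`, a valuation ring `O` of `K`, a finitely generated `k`-subalgebra `A₀ ⊆ O`, `t ∈ K` with
`Frac (A₀[t]) = K`, `p ≥ 1`, a sequence `R : ℕ → Subring K` with `R 0 = (A₀)_{𝔪_O ∩ A₀}` whose first `N` steps are
LOCAL BLOWINGS UP with respect to `O` (Novacoski–Spivakovsky Def. 2.8 — in the sketch: along the σ_top centres `P i`,
Def. 2.11, `IsLocalBlowupAlong.isLocalBlowup`), torsor generators `s` with `s 0 = t` and `s i = x_i · s (i+1) + g_i`,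
`x_i, g_i ∈ R i` (`IsStrictStepAlong`, only these memberships are used), `(s N) ^ p ∈ R N`, `R N` local, and the torsor
germ `B := (R N)_𝔪[T]/(T ^ p − (s N) ^ p)` a REGULAR LOCAL RING (`SteeredExitAt`: `¬ IsSingPrime (R N) p ((s N)^p) 𝔪`):
SOME finitely generated `A ⊇ A₀` with `t ∈ A ⊆ O` and `Frac A = K` is regular at the centre of `O` (`Concl O A₀ t`).

## Proof

(1) `SteeredExit.isLocalBlowup_of_tower` / `exists_model_of_tower`: the first `N` steps compose to ONE local blowing up
of `A₀` (`IsLocalBlowup.trans` from `locAtCentre_self`), so `R N = (A₁)_{𝔪_O ∩ A₁}` for a finitely generated model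
`A₀ ≤ A₁ ⊆ O` (`closure_subalgebra_union_eq`, `fg_adjoin_subalgebra_union`). (2) The run gives `t = X · s N + G` with
`X, G ∈ R N` (`OrderOneExit.exists_eq_mul_add_of_run`-shape, here `exists_eq_mul_add_of_steps`). (3)
`SteeredExit.concl_of_radicandRing_regular` — the packaging of the landed `orderOneExit` (res-L0-w41-stub-3, p479657)
with the root adjunction replaced by the HYPOTHESIS that `B` is regular: `(R N)_𝔪 ≅ R N` (`IsLocalization.atUnits`),
`B` is a domain finite over it, so the lift `ψ : B → K`, `T ↦ s N`, is injective (`Ideal.eq_bot_of_comap_eq_bot`) and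
`T := ψ(B) = (R N)[s N] ⊆ O` is a regular ring (`isRegularLocalRing_localization_atPrime`, Matsumura Thm. 19.3);
the model `A := A₁[t][s N]` satisfies `A ⊆ T ⊆ A_𝔮` inside `K` (Novacoski–Spivakovsky Lemma 2.5 (1):
`centreLocalization_le`, `isRegularLocalRing_of_centreLocalization_eq`), hence is regular at the centre.
No irreducibility of `T ^ p − (s N) ^ p`, no step / multiplicity hypothesis and no binder of the sketch's `CoreDatum`
beyond `A₀.FG` and `Frac (A₀[t]) = K` is used. [cite: NovacoskiSpivakovsky2014, Def. 2.8, Def. 2.11, Lemma 2.5, Lemma 2.9]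
[cite: Matsumura1987, Thm. 19.3] [folklore]
-/

noncomputable section

-- `Summit.<S>.<S>.…` duplicates the summit name by design (single-problem summit).
set_option linter.dupNamespace false

open Polynomial IsLocalRing

namespace Summit.ResolutionOfSingularities.ResolutionOfSingularities.Theorems.SwitchingDichotomy

open Literature.AlgebraicGeometry.Resolution
open Summit.ResolutionOfSingularities.ResolutionOfSingularities.Theorems.PfaffLine
  (adjoinRoot_mem_subring mem_valuationSubring_of_pow_mem adjoin_insert_toSubring_le le_adjoin_insert
    mem_adjoin_insert fg_adjoin_insert isRegularLocalRing_centre_of_ringEquiv)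

namespace SteeredExit

variable {k K : Type} [Field k] [Field K] [Algebra k K]

/-! ## (1) Towers of local blowings up have finitely generated models -/

section Model

/-- **The first `N` steps of a tower of local blowings up compose to one local blowing up of the base**
(`R 0 = B_{𝔪_O ∩ B}` is the trivial local blowing up; Novacoski–Spivakovsky Lemma 2.9, tree `IsLocalBlowup.trans`).
[cite: NovacoskiSpivakovsky2014, Lemma 2.9] -/
theorem isLocalBlowup_of_tower (O : ValuationSubring K) {B : Subring K} (hB : B ≤ O.toSubring)
    {R : ℕ → Subring K} (hR0 : R 0 = locAtCentre B O) {N : ℕ}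
    (hstep : ∀ i < N, IsLocalBlowup O (R i) (R (i + 1))) : IsLocalBlowup O B (R N) := by
  induction N with
  | zero => rw [hR0]; exact IsLocalBlowup.locAtCentre_self hB
  | succ N ih =>
    exact (ih fun i hi => hstep i (Nat.lt_succ_of_lt hi)).trans (hstep N (Nat.lt_succ_self N))

/-- **The member `R N` of a tower of local blowings up of `(A₀)_{𝔪_O ∩ A₀}` is the local ring at the centre of `O` of
a finitely generated model `A₀ ≤ A₁ ⊆ O`** (`A₁ = A₀[t]` for the finitely many new elements `t ⊆ O` of the composed
local blowing up). [cite: NovacoskiSpivakovsky2014, Def. 2.8 and Lemma 2.9] -/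
theorem exists_model_of_tower (O : ValuationSubring K) (A₀ : Subalgebra k K)
    (h₀ : A₀.toSubring ≤ O.toSubring) (hfg : A₀.FG) {R : ℕ → Subring K}
    (hR0 : R 0 = locAtCentre A₀.toSubring O) {N : ℕ} (hstep : ∀ i < N, IsLocalBlowup O (R i) (R (i + 1))) :
    ∃ (A₁ : Subalgebra k K), A₁.toSubring ≤ O.toSubring ∧ A₀ ≤ A₁ ∧ A₁.FG ∧
      locAtCentre A₁.toSubring O = R N := by
  obtain ⟨-, t, ht, hRN⟩ := isLocalBlowup_of_tower O h₀ hR0 hstep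
  refine ⟨Algebra.adjoin k ((A₀ : Set K) ∪ ↑t), ?_, fun x hx => Algebra.subset_adjoin (Or.inl hx),
    fg_adjoin_subalgebra_union A₀ hfg t, ?_⟩
  · rw [← closure_subalgebra_union_eq]
    exact Subring.closure_le.mpr (Set.union_subset h₀ ht)
  · rw [← closure_subalgebra_union_eq]
    exact hRN.symm

end Model

/-! ## (2) The run bookkeeping: `t ∈ (R N)[s N]` -/

section Run

/-- **Along strict-transform steps `s i = x_i · s (i+1) + g_i` (`x_i, g_i ∈ R i`, `R` increasing up to `N`),
`t = s 0 = X · s N + G` with `X, G ∈ R N`.** [folklore] -/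
theorem exists_eq_mul_add_of_steps {R : ℕ → Subring K} {t : K} {s : ℕ → K} {N : ℕ} (hs0 : s 0 = t)
    (hmono : ∀ i < N, R i ≤ R (i + 1))
    (hss : ∀ i < N, ∃ x g : K, x ∈ R i ∧ g ∈ R i ∧ s i = x * s (i + 1) + g) :
    ∃ X ∈ R N, ∃ G ∈ R N, t = X * s N + G := by
  have key : ∀ i ≤ N, ∃ X ∈ R i, ∃ G ∈ R i, t = X * s i + G := by
    intro i
    induction i with
    | zero => exact fun _ => ⟨1, (R 0).one_mem, 0, (R 0).zero_mem, by rw [hs0, one_mul, add_zero]⟩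
    | succ i ih =>
      intro hi
      have hi' : i < N := Nat.lt_of_succ_le hi
      obtain ⟨X, hX, G, hG, ht⟩ := ih hi'.le
      obtain ⟨x, g, hx, hg, hsi⟩ := hss i hi'
      have hle : R i ≤ R (i + 1) := hmono i hi'
      refine ⟨X * x, hle ((R i).mul_mem hX hx), X * g + G,
        hle ((R i).add_mem ((R i).mul_mem hX hg) hG), ?_⟩
      rw [ht, hsi]; ring
  exact key N le_rfl

/-- Hence `t ∈ (R N)[s N]` (the subring generated by `R N` and `s N`). [folklore] -/
theorem mem_closure_insert_of_steps {R : ℕ → Subring K} {t : K} {s : ℕ → K} {N : ℕ} (hs0 : s 0 = t)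
    (hmono : ∀ i < N, R i ≤ R (i + 1))
    (hss : ∀ i < N, ∃ x g : K, x ∈ R i ∧ g ∈ R i ∧ s i = x * s (i + 1) + g) :
    t ∈ Subring.closure (insert (s N) (R N : Set K)) := by
  obtain ⟨X, hX, G, hG, ht⟩ := exists_eq_mul_add_of_steps hs0 hmono hss
  rw [ht]
  exact Subring.add_mem _ (Subring.mul_mem _ (Subring.subset_closure (Set.mem_insert_of_mem _ hX))
    (Subring.subset_closure (Set.mem_insert _ _))) (Subring.subset_closure (Set.mem_insert_of_mem _ hG))

end Run

/-! ## (3) The exit: a torsor germ that is regular over the closed point of the local ring of a model -/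

section Exit

/-- **The regular-torsor exit over the local ring at the centre of a finitely generated model** (the packaging of the
landed `orderOneExit`, p479657, with root adjunction replaced by the regularity HYPOTHESIS). Let `A₀ ≤ A₁ ⊆ O` be
finitely generated `k`-subalgebras of `K`, `S := (A₁)_{𝔪_O ∩ A₁}` realised inside `K`, `Frac (A₀[t]) = K`, `p ≥ 1`,
`w ∈ K` with `w ^ p ∈ S` and `t ∈ S[w]`. If the torsor germ `S_𝔪[T]/(T ^ p − w ^ p)` is a regular local ring, then some
finitely generated `A ⊇ A₀` with `t ∈ A ⊆ O`, `Frac A = K` is regular at the centre of `O` — namely `A = A₁[t][w]`,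
compared inside `K` with the regular ring `S[w] ≅ S_𝔪[T]/(T ^ p − w ^ p)`.
[cite: NovacoskiSpivakovsky2014, Lemma 2.5] [cite: Matsumura1987, Thm. 19.3] [folklore] -/
theorem concl_of_radicandRing_regular (O : ValuationSubring K) (A₀ A₁ : Subalgebra k K)
    (h₁ : A₁.toSubring ≤ O.toSubring) (hle : A₀ ≤ A₁) (hfg₁ : A₁.FG) (S : Subring K) (hloc : IsLocalRing S)
    (hS : locAtCentre A₁.toSubring O = S) (t w : K)
    (hfr : IsFractionRing (Algebra.adjoin k (insert t (A₀ : Set K))) K) {p : ℕ} (hp : 0 < p)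
    (hw : w ^ p ∈ S) (ht : t ∈ Subring.closure (insert w (S : Set K)))
    (hreg : IsRegularLocalRing (AdjoinRoot
      (X ^ p - C (algebraMap S (Localization.AtPrime (maximalIdeal S)) ⟨w ^ p, hw⟩)))) :
    ∃ (A : Subalgebra k K) (h : A.toSubring ≤ O.toSubring), A₀ ≤ A ∧ t ∈ A ∧ A.FG ∧
      IsFractionRing A K ∧ IsRegularLocalRing (Localization.AtPrime
        (Ideal.comap (Subring.inclusion h) (IsLocalRing.maximalIdeal O))) := by
  classical
  -- ### the base `S` and its realisation by the model `A₁`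
  have hSO : S ≤ O.toSubring := hS ▸ locAtCentre_le h₁
  have hA₁S : A₁.toSubring ≤ S := hS ▸ le_locAtCentre A₁.toSubring O
  have hSfrac : ∀ r ∈ S, ∃ a ∈ A₁, ∃ c ∈ A₁, O.valuation c = 1 ∧ r = a / c := fun r hr => by
    rw [← hS] at hr
    exact mem_locAtCentre_iff.mp hr
  have hwO : w ∈ O := mem_valuationSubring_of_pow_mem O hp.ne' (hSO hw)
  have hclO : Subring.closure (insert w (S : Set K)) ≤ O.toSubring :=
    Subring.closure_le.mpr (Set.insert_subset hwO hSO)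
  have htO : t ∈ O := hclO ht
  -- ### the model `A = A₁[t][w]`
  set At : Subalgebra k K := Algebra.adjoin k (insert t (A₁ : Set K))
  set A : Subalgebra k K := Algebra.adjoin k (insert w (At : Set K))
  have hAtO : At.toSubring ≤ O.toSubring := adjoin_insert_toSubring_le O.toSubring A₁ h₁ htO
  have hAO : A.toSubring ≤ O.toSubring := adjoin_insert_toSubring_le O.toSubring At hAtO hwO
  have hA₁A : A₁ ≤ A := (le_adjoin_insert A₁ t).trans (le_adjoin_insert At w)
  have hA₀A : A₀ ≤ A := hle.trans hA₁A
  have htA : t ∈ A := le_adjoin_insert At w (mem_adjoin_insert A₁ t)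
  have hwA : w ∈ A := mem_adjoin_insert At w
  haveI := hfr
  have hA₀tA : Algebra.adjoin k (insert t (A₀ : Set K)) ≤ A :=
    Algebra.adjoin_le (Set.insert_subset htA fun x hx => hA₀A hx)
  have hAfr : IsFractionRing A K :=
    isFractionRing_subalgebra_of_le (Algebra.adjoin k (insert t (A₀ : Set K))) A hA₀tA
  refine ⟨A, hAO, hA₀A, htA, fg_adjoin_insert (fg_adjoin_insert hfg₁ t) w, hAfr, ?_⟩
  -- ### the base `S ≅ S_𝔪` and the embedding `φ : S_𝔪 → K`
  haveI := hloc
  set L := Localization.AtPrime (maximalIdeal S)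
  -- a local ring is its own localisation at the maximal ideal
  have hunits : (maximalIdeal S).primeCompl ≤ IsUnit.submonoid S := fun x hx => by
    have hx' : x ∉ maximalIdeal S := hx
    rwa [mem_maximalIdeal, mem_nonunits_iff, not_not] at hx'
  let e : S ≃ₐ[S] L := IsLocalization.atUnits S (maximalIdeal S).primeCompl hunits
  let φ : L →+* K := S.subtype.comp e.symm.toRingEquiv.toRingHom
  have hφalg : ∀ x : S, φ (algebraMap S L x) = (x : K) := fun x => by
    show (S.subtype (e.symm (algebraMap S L x))) = (x : K)
    rw [AlgEquiv.commutes]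
    rfl
  have hφmem : ∀ y : L, φ y ∈ S := fun y => (e.symm y).2
  have hφinj : Function.Injective φ := S.subtype_injective.comp e.symm.injective
  -- ### the abstract torsor germ `B = S_𝔪[T]/(T ^ p − w ^ p)` and its embedding `ψ : B → K`, `T ↦ w`
  set f : L[X] := X ^ p - C (algebraMap S L ⟨w ^ p, hw⟩) with hf
  have hev : f.eval₂ φ w = 0 := by
    rw [hf, eval₂_sub, eval₂_X_pow, eval₂_C, hφalg]
    exact sub_self _
  haveI := hreg
  haveI : IsDomain (AdjoinRoot f) := isDomain_of_isRegularLocalRing _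
  haveI : Module.Finite L (AdjoinRoot f) := (monic_X_pow_sub_C _ hp.ne').finite_adjoinRoot
  haveI : Algebra.IsIntegral L (AdjoinRoot f) := inferInstance
  set ψ : AdjoinRoot f →+* K := AdjoinRoot.lift φ w hev
  have hψof : ∀ y : L, ψ (AdjoinRoot.of f y) = φ y := fun y => AdjoinRoot.lift_of hev
  have hψroot : ψ (AdjoinRoot.root f) = w := AdjoinRoot.lift_root hev
  have hψinj : Function.Injective ψ := by
    rw [RingHom.injective_iff_ker_eq_bot]
    apply Ideal.eq_bot_of_comap_eq_bot (R := L)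
    rw [AdjoinRoot.algebraMap_eq, RingHom.comap_ker, AdjoinRoot.lift_comp_of, ← RingHom.injective_iff_ker_eq_bot]
    exact hφinj
  -- ### its image `T = S[w] ⊆ O`, a model containing `A`
  let T : Subalgebra k K :=
    { ψ.range with
      algebraMap_mem' := fun x =>
        ⟨AdjoinRoot.of f (algebraMap S L ⟨algebraMap k K x, hA₁S (A₁.algebraMap_mem x)⟩),
          by rw [hψof, hφalg]⟩ }
  have hmemT : ∀ {S' : Subring K}, S ≤ S' → w ∈ S' → (T : Set K) ⊆ S' := by
    intro S' hS' hwS'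
    rintro _ ⟨x, rfl⟩
    refine adjoinRoot_mem_subring f (S'.comap ψ) (fun y => ?_) ?_ x
    · rw [Subring.mem_comap, hψof]
      exact hS' (hφmem y)
    · rw [Subring.mem_comap, hψroot]
      exact hwS'
  have hTO : T.toSubring ≤ O.toSubring := fun x hx => hmemT (S' := O.toSubring) hSO hwO hx
  have hST : ∀ r ∈ S, r ∈ T := fun r hr =>
    ⟨AdjoinRoot.of f (algebraMap S L ⟨r, hr⟩), by rw [hψof, hφalg]⟩
  have hwT : w ∈ T := ⟨_, hψroot⟩
  have hclT : Subring.closure (insert w (S : Set K)) ≤ T.toSubring :=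
    Subring.closure_le.mpr (Set.insert_subset hwT fun r hr => hST r hr)
  have htT : t ∈ T := hclT ht
  have hA₁T : (A₁ : Set K) ⊆ T := fun a ha => hST a (hA₁S ha)
  have hAtT : At ≤ T := Algebra.adjoin_le (Set.insert_subset htT hA₁T)
  have hAT : A ≤ T := Algebra.adjoin_le (Set.insert_subset hwT hAtT)
  haveI : IsFractionRing A.toSubring K := hAfr
  haveI : IsFractionRing T.toSubring K := isFractionRing_subalgebra_of_le A T hAT
  -- ### `A ⊆ T ⊆ A_𝔮` inside `K`: the two models have the same local ring at the centre
  have hTΛ : (T : Set K) ⊆ Localization.subalgebra.ofField K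
      ((maximalIdeal O).comap (Subring.inclusion hAO)).primeCompl
      (Ideal.primeCompl_le_nonZeroDivisors _) := by
    refine hmemT (S' := (Localization.subalgebra.ofField K
      ((maximalIdeal O).comap (Subring.inclusion hAO)).primeCompl
      (Ideal.primeCompl_le_nonZeroDivisors _)).toSubring) (fun r hr => ?_)
      (le_centreLocalization O A hAO hwA)
    rw [Subalgebra.mem_toSubring, mem_centreLocalization_iff]
    obtain ⟨a, ha, c, hc, hc1, rfl⟩ := hSfrac r hr
    exact ⟨a, hA₁A ha, c, hA₁A hc, hc1, div_eq_mul_inv a c⟩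
  have heq : ((Localization.subalgebra.ofField K
      ((maximalIdeal O).comap (Subring.inclusion hAO)).primeCompl
      (Ideal.primeCompl_le_nonZeroDivisors _)) : Set K) =
      Localization.subalgebra.ofField K
      ((maximalIdeal O).comap (Subring.inclusion hTO)).primeCompl
      (Ideal.primeCompl_le_nonZeroDivisors _) :=
    le_antisymm (centreLocalization_le O A T hAO hTO
        ((show (A : Set K) ⊆ T from hAT).trans (le_centreLocalization O T hTO)))
      (centreLocalization_le O T A hTO hAO hTΛ)
  refine isRegularLocalRing_of_centreLocalization_eq O A T hAO hTO heq ?_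
  -- ### `T ≅ B` is a regular ring, so its localisation at the centre is regular
  let ψ' : AdjoinRoot f →+* T.toSubring := ψ.codRestrict T.toSubring fun x => ⟨x, rfl⟩
  have hψ'bij : Function.Bijective ψ' :=
    ⟨fun x y hxy => hψinj (congrArg Subtype.val hxy), fun ⟨y, x, hx⟩ => ⟨x, Subtype.ext hx⟩⟩
  exact isRegularLocalRing_centre_of_ringEquiv O T hTO (RingEquiv.ofBijective ψ' hψ'bij)
    (isRegularLocalRing_localization_atPrime _ _)

end Exit

/-! ## X `SteeredExit` -/

/-- **X `SteeredExit`** (piece X of the R2 σ_top line; vocabulary read through): for `A₀ ⊆ O` finitely generated,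
`Frac (A₀[t]) = K`, `p ≥ 1`, a sequence `R` with `R 0 = (A₀)_{𝔪_O ∩ A₀}` whose first `N` steps are local blowings up
with respect to `O`, torsor generators `s` (`s 0 = t`, `s i = x_i · s (i+1) + g_i` with `x_i, g_i ∈ R i` for `i < N`)
with `(s N) ^ p ∈ R N`, `R N` local, and the torsor germ `(R N)_𝔪[T]/(T ^ p − (s N) ^ p)` a regular local ring, the
datum `(A₀, t)` has a regular model: some finitely generated `A ⊇ A₀`, `t ∈ A ⊆ O`, `Frac A = K`, regular at the
centre of `O`. [cite: NovacoskiSpivakovsky2014, Def. 2.8/2.11, Lemma 2.5, Lemma 2.9] [cite: Matsumura1987, Thm. 19.3]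
[folklore] -/
theorem concl_of_exit (O : ValuationSubring K) (A₀ : Subalgebra k K) (h₀ : A₀.toSubring ≤ O.toSubring)
    (t : K) (hfg : A₀.FG) (hfr : IsFractionRing (Algebra.adjoin k (insert t (A₀ : Set K))) K)
    {p : ℕ} (hp : 0 < p) (R : ℕ → Subring K) (hR0 : R 0 = locAtCentre A₀.toSubring O)
    (s : ℕ → K) (N : ℕ) (hs0 : s 0 = t)
    (hstep : ∀ i < N, IsLocalBlowup O (R i) (R (i + 1)) ∧
      ∃ x g : K, x ∈ R i ∧ g ∈ R i ∧ s i = x * s (i + 1) + g)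
    (hloc : IsLocalRing (R N)) (hsN : s N ^ p ∈ R N)
    (hreg : IsRegularLocalRing (AdjoinRoot
      (X ^ p - C (algebraMap (R N) (Localization.AtPrime (maximalIdeal (R N))) ⟨s N ^ p, hsN⟩)))) :
    ∃ (A : Subalgebra k K) (h : A.toSubring ≤ O.toSubring), A₀ ≤ A ∧ t ∈ A ∧ A.FG ∧
      IsFractionRing A K ∧ IsRegularLocalRing (Localization.AtPrime
        (Ideal.comap (Subring.inclusion h) (IsLocalRing.maximalIdeal O))) := by
  obtain ⟨A₁, h₁, hle, hfg₁, hRN⟩ :=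
    exists_model_of_tower O A₀ h₀ hfg hR0 (N := N) fun i hi => (hstep i hi).1
  have ht : t ∈ Subring.closure (insert (s N) (R N : Set K)) :=
    mem_closure_insert_of_steps hs0 (fun i hi => (hstep i hi).1.le) fun i hi => (hstep i hi).2
  exact concl_of_radicandRing_regular O A₀ A₁ h₁ hle hfg₁ (R N) hloc hRN t (s N) hfr hp hsN ht hreg

end SteeredExit

end Summit.ResolutionOfSingularities.ResolutionOfSingularities.Theorems.SwitchingDichotomy

end
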